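import Literature.NumberTheory.Sieve.BombieriAsymptoticSievePrDistributionProofs
import Literature.NumberTheory.Sieve.BombieriAsymptoticSieveVectorProofs
import HarnessLib

/-!
# Bombieri's asymptotic sieve on `P₂`: the two named facts DISCHARGED

Topic `Literature/NumberTheory/Sieve`, family `parity`. Pure composition (no definition, no named
fact): the tree proves

* `Bombieri1976_P2DistributionLaw_of_vector : Bombieri1976_asymptotic_sieve_vector → Bombieri1976_P2DistributionLaw`
  and `Bombieri1976_P2Distribution_of_vector` (`BombieriAsymptoticSievePrDistributionProofs.lean`:
  the parity functional, the balanced weights `Q_m`, moments and Weierstrass approximation), and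
* `Bombieri1976_asymptotic_sieve_vector_holds` (`BombieriAsymptoticSieveVectorProofs.lean`:
  [FriedlanderIwaniecPisa1978] Theorem 1 (Bombieri) for a general vector `(k)`),

in two files with disjoint import closures; this leaf module joins them. Hence the case `r = 2` of
the Theorem of [BombieriRIMS1977] p. 5 — the distribution law of a sifted sequence on the products
of two primes, `γ_x ≡ 2 − δ_x` — holds unconditionally on the tree's statement
(`Bombieri1976_P2DistributionLaw_holds`), and so does its special case
`Bombieri1976_P2Distribution` (`Bombieri1976_P2Distribution_holds`), which grounds
`Summit.Parity.GeneralizedHardyLittlewood.Theses.RoughSemiprimeRigidity.BombieriRoughP2Law`.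

## References

* E. Bombieri, *The asymptotic sieve*, RIMS Kôkyûroku 294 (1977) 1–8, Theorem p. 5 (case `r = 2`),
  Definition p. 5, pp. 4 and 6. [BombieriRIMS1977]
* J. Friedlander, H. Iwaniec, *On Bombieri's asymptotic sieve*, Ann. Sc. Norm. Super. Pisa (4) 5
  (1978) 719–756, Theorem 1 (p. 722). [FriedlanderIwaniecPisa1978]
-/

namespace Literature.NumberTheory.Sieve

/-- **Bombieri's asymptotic sieve — the distribution law on `P₂`, DISCHARGED**: the named fact
`Bombieri1976_P2DistributionLaw` ([BombieriRIMS1977] Theorem p. 5, case `r = 2`, with the test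
functions `u₁u₂ g(u₁)`, `g` continuous on `[0, 1/2]`) holds, by
`Bombieri1976_P2DistributionLaw_of_vector` applied to the discharged vector form of Bombieri's
Theorem 1, `Bombieri1976_asymptotic_sieve_vector_holds`.
[cite: BombieriRIMS1977, Theorem p. 5 (case r = 2), Definition p. 5, pp. 4 and 6] -/
theorem Bombieri1976_P2DistributionLaw_holds : Bombieri1976_P2DistributionLaw :=
  Bombieri1976_P2DistributionLaw_of_vector Bombieri1976_asymptotic_sieve_vector_holds

/-- **Bombieri's asymptotic sieve on `P₂` (test functions vanishing near `u₁ = 0`), DISCHARGED**: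
the named fact `Bombieri1976_P2Distribution` holds (`Bombieri1976_P2Distribution_of_vector` with
`Bombieri1976_asymptotic_sieve_vector_holds`).
[cite: BombieriRIMS1977, p. 5 Theorem (case r = 2); definitions pp. 4-5; meaning of ∼ p. 6 Corollary] -/
theorem Bombieri1976_P2Distribution_holds : Bombieri1976_P2Distribution :=
  Bombieri1976_P2Distribution_of_vector Bombieri1976_asymptotic_sieve_vector_holds

end Literature.NumberTheory.Sieve
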